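import Literature.AlgebraicGeometry.Resolution.DiffOpCartierShift
import HarnessLib

/-!
# Monomial `p`-basis calculus for `x`-Cartier extensions, II: the order bound `Δ ∈ Diff^{≤ m·q}` for `σ ∈ Diff^{≤ m}`

Topic `Literature/AlgebraicGeometry/Resolution`, continuation of `DiffOpCartierShift.lean` (setting, hypotheses (P1)/(P2),
shift identity) and `DiffOpOfFrobeniusLinear.lean` (`ad_f^{p^N} = [·, f^{p^N}]`, `isDiffOpLE_of_adMul_pow_apply_eq_zero`).

An `R`-linear `σ : S → S` has the «`x`-CARTIER EXTENSION» shape `Θ_σ(Σ_α x^α h_α) = Σ_α x^α σ(h_α)` (Hironaka 2017,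
Lem. 3.6 / Def. 3.7, Eq. (10) p.9). MAIN THEOREM (`isDiffOpLE_mul_of_cartierShape`):

  `σ ∈ Diff^{≤ m}_{S/R}` ⟹ every `Δ` with `Δ(Σ_α x^α h_α) = Σ_α x^α σ(h_α)` lies in `Diff^{≤ m·q}_{A/R}`

(under (P1)/(P2), `xᵢ^q ∈ S`, and the Frobenius nilpotency `ad_{xᵢ}^q T = 0` for `S`-linear `T`) — the sharp order
bound «`∆(ℓ) ∈ Diff^{(mp^ℓ)}`» of ms. p.38 l.6–7 (typed `Hironaka2017.S07Permissible.U38L6`, HIRONAKA-L Q-07-028), which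
Lem. 3.6 as printed does not state. PROOF: weight induction on `W = q·ord(τ) + ord(T)` for the operators `Θ_τ ∘ T`,
`T` an `S`-linear differential operator: `[Θ_τ, s] = Θ_{[τ,s]}` (`s ∈ S`), and `[Θ_τ, xᵢ] = Θ_{[τ, xᵢ^q]} ∘ Pᵢ` with the
`S`-linear «carry» operator `Pᵢ(Σ_α x^α h_α) = Σ_{α_i = q−1} x^{α − (q−1)eᵢ} h_α` of order `≤ q − 1` (it commutes with
`S` and with `x_j`, `j ≠ i`, and `ad_{xᵢ}^q Pᵢ = 0`), closing with EGA's generator form of 16.8.8 (b). No definitions: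
operators are handled through their characterising identities (`∀ f, Θ f = Σ_α x^α τ(π_α f)` etc.).

## References
* A. Grothendieck, J. Dieudonné, ÉGA IV₄, Publ. Math. IHÉS 32 (1967), §16.8, Prop. 16.8.8 (b), Prop. 16.8.9. [EGAIV4]
* E. Kunz, Amer. J. Math. 91 (1969), Thm. 2.1 (the monomial `p`-basis of a regular local ring). [Kunz1969]
* H. Hironaka, ms. 2017-03-23, Lem. 3.6 p.9, p.38 l.6–7. [Hironaka2017] (unrefereed manuscript under adjudication — kernel
  support, nothing of the manuscript asserted)
-/

namespace Literature.AlgebraicGeometry.Resolution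

open Finset

universe u v

section Cartier

variable (R : Type u) {A : Type v} [CommRing R] [CommRing A] [Algebra R A] {n q : ℕ}
  (x : Fin n → A) (e : (Fin n → Fin q) → A) (S : Subalgebra R A) (π : (Fin n → Fin q) → A →ₗ[R] S)

/-! ### The carry operator `Pᵢ` and the Cartier-shaped operators `Θ_τ`, through their characterising identities -/

section WithBasis

variable (hq : 0 < q) (he : ∀ α, e α = ∏ j, x j ^ ((α j : Fin q) : ℕ)) (hxS : ∀ i, x i ^ q ∈ S)
  (hπ₁ : ∀ f : A, f = ∑ α, e α * (π α f : A))
  (hπ₂ : ∀ (h : (Fin n → Fin q) → S) (α : Fin n → Fin q), π α (∑ β, e β * (h β : A)) = h α)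

include hq in
/-- Existence of the carry operator `Pᵢ(f) = Σ_{β : β_i = 0} x^β π_{β[i ↦ q−1]}(f)` as an `R`-linear map. [folklore] -/
private theorem exists_carryOp (i : Fin n) :
    ∃ P : A →ₗ[R] A, ∀ f : A, P f = ∑ β : Fin n → Fin q, if ((β i : Fin q) : ℕ) = 0 then
      e β * (π (Function.update β i ⟨q - 1, Nat.sub_lt hq Nat.one_pos⟩) f : A) else 0 := by
  classical
  refine ⟨∑ β ∈ Finset.univ.filter (fun β : Fin n → Fin q => ((β i : Fin q) : ℕ) = 0),
      LinearMap.mulLeft R (e β) ∘ₗ (S.val.toLinearMap ∘ₗ π (Function.update β i ⟨q - 1, Nat.sub_lt hq Nat.one_pos⟩)),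
    fun f => ?_⟩
  rw [LinearMap.sum_apply, Finset.sum_filter]
  refine Finset.sum_congr rfl fun β _ => ?_
  split_ifs
  · rfl
  · rfl

/-- **Existence of the Cartier-shaped operator** `Θ_τ(f) = Σ_α x^α τ(π_α f)` as an `R`-linear map — with (P1)/(P2)
this is the `x`-Cartier extension of `τ` (`cartierOp_apply_sum`: Hironaka's Eq. (10)). [cite: Hironaka2017, Lem 3.6
p.9 l.59–67 «∂(Σ x^α h_α) = Σ x^α σ(h_α)» (unrefereed manuscript under adjudication — kernel support, nothing of the
manuscript asserted)] -/
theorem exists_cartierOp (τ : S →ₗ[R] S) :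
    ∃ Θ : A →ₗ[R] A, ∀ f : A, Θ f = ∑ α, e α * (τ (π α f) : A) :=
  ⟨∑ α, LinearMap.mulLeft R (e α) ∘ₗ (S.val.toLinearMap ∘ₗ (τ ∘ₗ π α)), fun f => by
    rw [LinearMap.sum_apply]; rfl⟩

include hπ₂ in
/-- A Cartier-shaped operator on a basis expansion: `Θ_τ(Σ_β x^β h_β) = Σ_β x^β τ(h_β)` (Hironaka's Eq. (10)).
[cite: Hironaka2017, Lem 3.6 Eq (10) p.9 (unrefereed manuscript under adjudication — kernel support, nothing of the
manuscript asserted)] -/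
theorem cartierOp_apply_sum {τ : S →ₗ[R] S} {Θ : A →ₗ[R] A}
    (hΘ : ∀ f : A, Θ f = ∑ α, e α * (τ (π α f) : A)) (h : (Fin n → Fin q) → S) :
    Θ (∑ β, e β * (h β : A)) = ∑ β, e β * (τ (h β) : A) := by
  rw [hΘ]
  exact Finset.sum_congr rfl fun β _ => by rw [hπ₂]

include hπ₂ in
/-- The carry operator on a basis expansion: `Pᵢ(Σ_β x^β h_β) = Σ_{β_i = 0} x^β h_{β[i ↦ q−1]}`. [folklore] -/
private theorem carryOp_apply_sum {i : Fin n} {P : A →ₗ[R] A}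
    (hP : ∀ f : A, P f = ∑ β : Fin n → Fin q, if ((β i : Fin q) : ℕ) = 0 then
      e β * (π (Function.update β i ⟨q - 1, Nat.sub_lt hq Nat.one_pos⟩) f : A) else 0)
    (h : (Fin n → Fin q) → S) :
    P (∑ β, e β * (h β : A)) = ∑ β : Fin n → Fin q, if ((β i : Fin q) : ℕ) = 0 then
      e β * (h (Function.update β i ⟨q - 1, Nat.sub_lt hq Nat.one_pos⟩) : A) else 0 := by
  rw [hP]
  exact Finset.sum_congr rfl fun β _ => by rw [hπ₂]

include hπ₁ hπ₂ in
/-- The carry operator commutes with `S`. [folklore] -/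
private theorem commMul_carryOp_mem {i : Fin n} {P : A →ₗ[R] A}
    (hP : ∀ f : A, P f = ∑ β : Fin n → Fin q, if ((β i : Fin q) : ℕ) = 0 then
      e β * (π (Function.update β i ⟨q - 1, Nat.sub_lt hq Nat.one_pos⟩) f : A) else 0)
    (s : S) : commMul R P s = 0 := by
  refine LinearMap.ext fun f => ?_
  rw [commMul_apply, LinearMap.zero_apply, sub_eq_zero, hP, hP, Finset.mul_sum]
  refine Finset.sum_congr rfl fun β _ => ?_
  rw [coord_mul_left R e S π hπ₁ hπ₂, Subalgebra.coe_mul]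
  split_ifs
  · ring
  · rw [mul_zero]

include hπ₁ hπ₂ in
/-- `[Θ_τ, s] = Θ_{[τ,s]}` for `s ∈ S`, pointwise: `[Θ_τ, s](f) = Σ_α x^α [τ, s](π_α f)`.
[cite: EGAIV4, Prop. 16.8.8 (16.8.8.1)] -/
theorem commMul_cartierOp_mem_apply {τ : S →ₗ[R] S} {Θ : A →ₗ[R] A}
    (hΘ : ∀ f : A, Θ f = ∑ α, e α * (τ (π α f) : A)) (s : S) (f : A) :
    commMul R Θ s f = ∑ α, e α * ((commMul R τ s) (π α f) : A) := by
  rw [commMul_apply, hΘ, hΘ, Finset.mul_sum, ← Finset.sum_sub_distrib]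
  refine Finset.sum_congr rfl fun α _ => ?_
  rw [coord_mul_left R e S π hπ₁ hπ₂, commMul_apply, Subalgebra.coe_sub, Subalgebra.coe_mul]
  ring

include hq he hxS hπ₁ hπ₂ in
/-- **The key commutation `[Θ_τ, xᵢ] = Θ_{[τ, xᵢ^q]} ∘ Pᵢ`**: multiplying by `xᵢ` shifts the exponents and carries at
`α_i = q − 1` through `xᵢ^q ∈ S`; the carry is where `τ` and `xᵢ^q` fail to commute.
[cite: EGAIV4, Prop. 16.8.8 (16.8.8.1); Kunz1969, Thm. 2.1] -/
theorem commMul_cartierOp_x (i : Fin n) {τ : S →ₗ[R] S} {Θ Θi P : A →ₗ[R] A}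
    (hΘ : ∀ f : A, Θ f = ∑ α, e α * (τ (π α f) : A))
    (hΘi : ∀ f : A, Θi f = ∑ α, e α * ((commMul R τ (⟨x i ^ q, hxS i⟩ : S)) (π α f) : A))
    (hP : ∀ f : A, P f = ∑ β : Fin n → Fin q, if ((β i : Fin q) : ℕ) = 0 then
      e β * (π (Function.update β i ⟨q - 1, Nat.sub_lt hq Nat.one_pos⟩) f : A) else 0) :
    commMul R Θ (x i) = Θi ∘ₗ P := by
  refine LinearMap.ext fun f => ?_
  set h : (Fin n → Fin q) → S := fun α => π α f with hh
  have hf : f = ∑ α, e α * (h α : A) := hπ₁ f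
  rw [LinearMap.comp_apply, commMul_apply, hf, x_mul_sum_monomial R x e S hq he i (hxS i) h,
    cartierOp_apply_sum R e S π hπ₂ hΘ, cartierOp_apply_sum R e S π hπ₂ hΘ,
    x_mul_sum_monomial R x e S hq he i (hxS i) (fun β => τ (h β)),
    carryOp_apply_sum R e S π hq hπ₂ hP]
  -- rewrite the carry sum as a basis expansion and apply `Θi`
  have hconv : (∑ β : Fin n → Fin q, if ((β i : Fin q) : ℕ) = 0 then
      e β * (h (Function.update β i ⟨q - 1, Nat.sub_lt hq Nat.one_pos⟩) : A) else 0) =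
      ∑ β : Fin n → Fin q, e β * ((if ((β i : Fin q) : ℕ) = 0 then
        h (Function.update β i ⟨q - 1, Nat.sub_lt hq Nat.one_pos⟩) else 0 : S) : A) :=
    Finset.sum_congr rfl fun β _ => by
      split_ifs
      · rfl
      · rw [Subalgebra.coe_zero, mul_zero]
  rw [hconv, cartierOp_apply_sum R e S π hπ₂ hΘi, ← Finset.sum_sub_distrib]
  refine Finset.sum_congr rfl fun β _ => ?_
  rw [← mul_sub]
  congr 1
  by_cases hβ : ((β i : Fin q) : ℕ) = 0
  · rw [if_pos hβ, if_pos hβ, if_pos hβ, commMul_apply, Subalgebra.coe_sub, Subalgebra.coe_mul]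
  · rw [if_neg hβ, if_neg hβ, if_neg hβ, sub_self, map_zero, Subalgebra.coe_zero]

include hq he hxS hπ₁ hπ₂ in
/-- The carry operator `Pᵢ` commutes with `x_j` for `j ≠ i` (the `j`-shift and the `i`-carry act on different
coordinates). [folklore] -/
private theorem commMul_carryOp_x_of_ne {i j : Fin n} (hji : j ≠ i) {P : A →ₗ[R] A}
    (hP : ∀ f : A, P f = ∑ β : Fin n → Fin q, if ((β i : Fin q) : ℕ) = 0 then
      e β * (π (Function.update β i ⟨q - 1, Nat.sub_lt hq Nat.one_pos⟩) f : A) else 0) :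
    commMul R P (x j) = 0 := by
  refine LinearMap.ext fun f => ?_
  set h : (Fin n → Fin q) → S := fun α => π α f with hh
  have hf : f = ∑ α, e α * (h α : A) := hπ₁ f
  rw [LinearMap.zero_apply, commMul_apply, hf, x_mul_sum_monomial R x e S hq he j (hxS j) h,
    carryOp_apply_sum R e S π hq hπ₂ hP, carryOp_apply_sum R e S π hq hπ₂ hP]
  -- the second carry sum as a basis expansion, then shift by `x_j`
  have hconv : (∑ β : Fin n → Fin q, if ((β i : Fin q) : ℕ) = 0 then
      e β * (h (Function.update β i ⟨q - 1, Nat.sub_lt hq Nat.one_pos⟩) : A) else 0) =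
      ∑ β : Fin n → Fin q, e β * ((if ((β i : Fin q) : ℕ) = 0 then
        h (Function.update β i ⟨q - 1, Nat.sub_lt hq Nat.one_pos⟩) else 0 : S) : A) :=
    Finset.sum_congr rfl fun β _ => by
      split_ifs
      · rfl
      · rw [Subalgebra.coe_zero, mul_zero]
  rw [hconv, x_mul_sum_monomial R x e S hq he j (hxS j), sub_eq_zero]
  refine Finset.sum_congr rfl fun β _ => ?_
  -- pointwise comparison of the two families
  have hij : ∀ (v w : Fin q), Function.update (Function.update β j v) i w =
      Function.update (Function.update β i w) j v := fun v w => Function.update_comm hji v w β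
  have hci : ∀ v : Fin q, ((Function.update β j v i : Fin q) : ℕ) = ((β i : Fin q) : ℕ) := fun v => by
    rw [Function.update_of_ne hji.symm]
  have hcj : ∀ w : Fin q, ((Function.update β i w j : Fin q) : ℕ) = ((β j : Fin q) : ℕ) := fun w => by
    rw [Function.update_of_ne hji]
  by_cases hβi : ((β i : Fin q) : ℕ) = 0
  · rw [if_pos hβi]
    by_cases hβj : ((β j : Fin q) : ℕ) = 0
    · rw [if_pos hβj, if_pos (by rw [hcj]; exact hβj), if_pos (by rw [hci]; exact hβi), hij,
        Subalgebra.coe_mul]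
    · rw [if_neg hβj, if_neg (by rw [hcj]; exact hβj), if_pos (by rw [hci]; exact hβi)]
      refine congrArg (fun γ => e β * (h γ : A)) ?_
      rw [hij]
      congr 1
      exact Fin.ext (by simp only [hcj])
  · rw [if_neg hβi]
    by_cases hβj : ((β j : Fin q) : ℕ) = 0
    · rw [if_pos hβj, if_neg (by rw [hci]; exact hβi), mul_zero, Subalgebra.coe_zero, mul_zero]
    · rw [if_neg hβj, if_neg (by rw [hci]; exact hβi), Subalgebra.coe_zero, mul_zero]

include hq he hxS hπ₁ hπ₂ in
/-- **The carry operator is a differential operator of order `≤ q − 1`**: it commutes with `S` and with the `x_j`,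
`j ≠ i`, and `ad_{xᵢ}^q Pᵢ = 0` (Frobenius nilpotency of `S`-linear operators, hypothesis `hFrob` —
`DiffOpOfFrobeniusLinear.adMul_pow_char_pow_apply` for `q = p^N`); the generator criterion with budget
`(q − 1) + Σ_{j ≠ i} 0` (`isDiffOpLE_of_adMul_pow_apply_eq_zero`). [cite: EGAIV4, Prop. 16.8.8 (b), Prop. 16.8.9] -/
private theorem isDiffOpLE_carryOp
    (hFrob : ∀ T : A →ₗ[R] A, (∀ s : S, commMul R T s = 0) → ∀ i, ((adMul R (x i)) ^ q) T = 0)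
    {i : Fin n} {P : A →ₗ[R] A}
    (hP : ∀ f : A, P f = ∑ β : Fin n → Fin q, if ((β i : Fin q) : ℕ) = 0 then
      e β * (π (Function.update β i ⟨q - 1, Nat.sub_lt hq Nat.one_pos⟩) f : A) else 0) :
    IsDiffOpLE R (q - 1) P := by
  classical
  have hPS : ∀ s : S, commMul R P s = 0 := commMul_carryOp_mem R e S π hq hπ₁ hπ₂ hP
  refine isDiffOpLE_of_adMul_pow_apply_eq_zero R (adjoin_eq_top_of_coord R x e S π he hπ₁) (q - 1)
    (fun s hs => hPS ⟨s, hs⟩) (Function.update (fun _ => 1) i q) ?_ ?_ ?_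
  · intro j
    rcases eq_or_ne j i with rfl | hj
    · rw [Function.update_self]; exact hq
    · rw [Function.update_of_ne hj]
  · intro j
    rcases eq_or_ne j i with rfl | hj
    · rw [Function.update_self]; exact hFrob P hPS j
    · rw [Function.update_of_ne hj, pow_one]
      exact commMul_carryOp_x_of_ne R x e S π hq he hxS hπ₁ hπ₂ hj hP
  · rw [Finset.sum_eq_single i (fun j _ hj => by rw [Function.update_of_ne hj]; rfl)
      (fun hi => absurd (Finset.mem_univ i) hi), Function.update_self]

include hπ₁ in
/-- Base of the weight induction: for `τ` of order `≤ 0` (a multiplication `s₀·` on `S`), `Θ_τ = s₀·` on `A`, so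
`Θ_τ ∘ T` has the order of `T`. [cite: EGAIV4, Déf. 16.8.1 (Diff^0 = multiplications)] -/
private theorem isDiffOpLE_cartierOp_comp_of_zero {τ : S →ₗ[R] S} (hτ : IsDiffOpLE R 0 τ) {Θ : A →ₗ[R] A}
    (hΘ : ∀ f : A, Θ f = ∑ α, e α * (τ (π α f) : A)) {k : ℕ} {T : A →ₗ[R] A} (hT : IsDiffOpLE R k T) :
    IsDiffOpLE R k (Θ ∘ₗ T) := by
  have hτ1 : τ = LinearMap.mulLeft R (τ 1) := isDiffOpLE_zero_iff_eq_mulLeft.mp hτ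
  have hτf : ∀ t : S, τ t = τ 1 * t := fun t => by
    have h := LinearMap.congr_fun hτ1 t
    rwa [LinearMap.mulLeft_apply] at h
  have hΘ' : Θ = LinearMap.mulLeft R ((τ 1 : S) : A) := by
    refine LinearMap.ext fun f => ?_
    rw [hΘ, LinearMap.mulLeft_apply]
    conv_rhs => rw [hπ₁ f, Finset.mul_sum]
    refine Finset.sum_congr rfl fun α _ => ?_
    rw [hτf, Subalgebra.coe_mul]
    ring
  rw [hΘ']
  simpa using (isDiffOpLE_mulLeft (R := R) ((τ 1 : S) : A)).comp hT

include hq he hxS hπ₁ hπ₂ in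
/-- **Weight induction**: if `τ ∈ Diff^{≤ j}_{S/R}`, `Θ` is Cartier-shaped for `τ`, and `T` is an `S`-linear
differential operator of order `≤ k`, then `Θ ∘ T ∈ Diff^{≤ W}_{A/R}` whenever `q·j + k ≤ W`. Step: `[Θ∘T, s] = Θ_{[τ,s]}∘T`
(weight drops by `q`), `[Θ∘T, xᵢ] = Θ_{[τ,xᵢ^q]} ∘ (Pᵢ ∘ T) + Θ ∘ [T, xᵢ]` (weight drops by `1`), and EGA's generator
criterion. [cite: EGAIV4, Prop. 16.8.8 (b), Prop. 16.8.9] -/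
theorem isDiffOpLE_cartierOp_comp
    (hFrob : ∀ T : A →ₗ[R] A, (∀ s : S, commMul R T s = 0) → ∀ i, ((adMul R (x i)) ^ q) T = 0) :
    ∀ (W j : ℕ) (τ : S →ₗ[R] S), IsDiffOpLE R j τ → ∀ (Θ : A →ₗ[R] A),
      (∀ f : A, Θ f = ∑ α, e α * (τ (π α f) : A)) → ∀ (k : ℕ) (T : A →ₗ[R] A), IsDiffOpLE R k T →
        (∀ s : S, commMul R T s = 0) → q * j + k ≤ W → IsDiffOpLE R W (Θ ∘ₗ T) := by
  intro W
  induction W with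
  | zero =>
    intro j τ hτ Θ hΘ k T hT hTS hW
    have hk : k = 0 := by omega
    have hqj : q * j = 0 := by omega
    have hj : j = 0 := (Nat.mul_eq_zero.mp hqj).resolve_left hq.ne'
    subst hk; subst hj
    exact isDiffOpLE_cartierOp_comp_of_zero R e S π hπ₁ hτ hΘ hT
  | succ W ih =>
    intro j τ hτ Θ hΘ k T hT hTS hW
    rcases Nat.eq_zero_or_pos j with rfl | hjpos
    · exact (isDiffOpLE_cartierOp_comp_of_zero R e S π hπ₁ hτ hΘ hT).of_le (by omega)
    obtain ⟨j', rfl⟩ : ∃ j', j = j' + 1 := ⟨j - 1, by omega⟩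
    have hW' : q * j' + k + q ≤ W + 1 := by rw [Nat.mul_succ] at hW; omega
    refine isDiffOpLE_succ_of_adjoin R (adjoin_eq_top_of_coord R x e S π he hπ₁) ?_
    rintro g (hg | ⟨i, rfl⟩)
    · -- `g ∈ S`: `[Θ ∘ T, g] = [Θ, g] ∘ T = Θ_{[τ,g]} ∘ T`
      have hTg : commMul R T g = 0 := hTS ⟨g, hg⟩
      rw [commMul_comp, hTg, LinearMap.comp_zero, add_zero]
      refine ih j' (commMul R τ ⟨g, hg⟩) (hτ ⟨g, hg⟩) (commMul R Θ g)
        (fun f => commMul_cartierOp_mem_apply R e S π hπ₁ hπ₂ hΘ ⟨g, hg⟩ f) k T hT hTS (by omega)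
    · -- `g = xᵢ`: `[Θ ∘ T, xᵢ] = Θ_{[τ,xᵢ^q]} ∘ (Pᵢ ∘ T) + Θ ∘ [T, xᵢ]`
      obtain ⟨Θi, hΘi⟩ := exists_cartierOp R e S π (commMul R τ (⟨x i ^ q, hxS i⟩ : S))
      obtain ⟨P, hP⟩ := exists_carryOp R e S π hq i
      rw [commMul_comp, commMul_cartierOp_x R x e S π hq he hxS hπ₁ hπ₂ i hΘ hΘi hP, LinearMap.comp_assoc]
      have hPS : ∀ s : S, commMul R P s = 0 := commMul_carryOp_mem R e S π hq hπ₁ hπ₂ hP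
      have hPT : IsDiffOpLE R (q - 1 + k) (P ∘ₗ T) :=
        (isDiffOpLE_carryOp R x e S π hq he hxS hπ₁ hπ₂ hFrob hP).comp hT
      have hPTS : ∀ s : S, commMul R (P ∘ₗ T) s = 0 := fun s => by
        rw [commMul_comp, hPS s, hTS s, LinearMap.zero_comp, LinearMap.comp_zero, add_zero]
      have h1 : IsDiffOpLE R W (Θi ∘ₗ (P ∘ₗ T)) :=
        ih j' _ (hτ ⟨x i ^ q, hxS i⟩) Θi hΘi (q - 1 + k) (P ∘ₗ T) hPT hPTS (by omega)
      refine h1.add ?_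
      cases k with
      | zero =>
        rw [hT (x i), LinearMap.comp_zero]
        exact IsDiffOpLE.zero W
      | succ k' =>
        exact ih (j' + 1) τ hτ Θ hΘ k' (commMul R T (x i)) (hT (x i))
          (fun s => commMul_commMul_eq_zero_of_commMul_eq_zero R (hTS s) (x i)) (by omega)

include hq he hxS hπ₁ hπ₂ in
/-- **The order of an `x`-Cartier extension.** In the abstract `p`-basis setting (P1)/(P2) with the Frobenius
nilpotency `ad_{xᵢ}^q T = 0` for `S`-linear `T`: if `σ ∈ Diff^{≤ m}_{S/R}` and `Δ : A → A` is `R`-linear with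
`Δ(Σ_α x^α h_α) = Σ_α x^α σ(h_α)` for every family `h` (Hironaka's Eq. (10)), then `Δ ∈ Diff^{≤ m·q}_{A/R}` — the bound
«`∆(ℓ) ∈ Diff^{(mp^ℓ)}`» of ms. p.38 l.6–7 for `q = p^ℓ`. [cite: EGAIV4, Prop. 16.8.8 (b), Prop. 16.8.9; Hironaka2017,
p.38 l.6–7 and Lem 3.6 Eq (10) p.9 (unrefereed manuscript under adjudication — kernel support, nothing of the
manuscript asserted)] -/
theorem isDiffOpLE_mul_of_cartierShape
    (hFrob : ∀ T : A →ₗ[R] A, (∀ s : S, commMul R T s = 0) → ∀ i, ((adMul R (x i)) ^ q) T = 0)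
    {m : ℕ} {σ : S →ₗ[R] S} (hσ : IsDiffOpLE R m σ) (Δ : A →ₗ[R] A)
    (hΔ : ∀ h : (Fin n → Fin q) → S, Δ (∑ β, e β * (h β : A)) = ∑ β, e β * (σ (h β) : A)) :
    IsDiffOpLE R (m * q) Δ := by
  have hΘ : ∀ f : A, Δ f = ∑ α, e α * (σ (π α f) : A) := fun f =>
    (congrArg Δ (hπ₁ f)).trans (hΔ _)
  have h := isDiffOpLE_cartierOp_comp R x e S π hq he hxS hπ₁ hπ₂ hFrob (m * q) m σ hσ Δ hΘ 0 LinearMap.id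
    isDiffOpLE_id (fun s => isDiffOpLE_id (s : A)) (by rw [Nat.mul_comm]; omega)
  rwa [LinearMap.comp_id] at h

end WithBasis

end Cartier

end Literature.AlgebraicGeometry.Resolution
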